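import Mathlib
import HarnessLib
import Summits.HubbardSuperconductivity.HubbardSuperconductivity.Theorems.KLProgrammeMatsubaraZeroSoundWeighted

/-!
# Route `KLProgramme` — ENGINE stmt-HubbardSuperconductivity-20437 `KLRegimeEngineV17F2`, row (c) value lane: the weighted zero-sound bubble with a QUASI-LIPSCHITZ insertion
# (brick 3′-1 of cure (A″) of located «(c)-OUT-COOPER-ANTIPODE», route «3′ QUASI-LIPSCHITZ» of CELL-SIGNATURES.md §G; cell gate-hubbard-kl, seat hubbard-kl-k3c2-p2 g25)

WHY.  The zero-sound chain (`klzw_* → klte_* → klsw_* → klfb_*`) asks the e-insertion `W` to be Lipschitz at `e = 0`: `‖W e − W 0‖ ≤ L_W|e|`.  On route 3′ the planar vertex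
weight is the landed GLOBAL McShane extension of the lattice pins (`klpeExt`, Lipschitz constant `K_g` of any size) and what a CELL of lattice data gives along a ray is only a
QUASI-Lipschitz datum `‖W e − W 0‖ ≤ L_W|e| + δ_W` with `δ_W ∝ (K_g + L_c)/L` (nearest-lattice-point argument).  The first-order cancellation tolerates the additive defect at
the price of `δ_W ×` the sign-blind mass of the box:
* `klzw_norm_integrand_sub_le_quasi` — pointwise `‖Ψ_G(k₀,e)·(W e − W 0)‖ ≤ L·r⁴·(L_W·r + δ_W)`;
* **`klzw_integral_plane_weighted_norm_le_quasi`** — `‖∫∫ G(k₀²+e²)(ik₀+e)²·W(e)‖ ≤ 4·L·L_W·r⁷ + 4·L·δ_W·r⁶`;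
* **`klzw_discrete_weighted_bubble_norm_le_quasi`** — the Matsubara-summed form `≤ (2π)⁻¹(4L·L_W·r⁷ + 4L·δ_W·r⁶) + 8L·B_W·r⁴(r + 2π/β)/β`.
`δ_W = 0` recovers the landed lemmas.  Pure analysis; nothing about the model is asserted.  0 kit · 0 lit.
-/

noncomputable section

namespace Summit.HubbardSuperconductivity.HubbardSuperconductivity.Theorems.KLRegimeSplit

set_option linter.dupNamespace false -- summit = problem name (single-conjunct summit), D-0017

open Real Finset MeasureTheory Complex Literature.MathematicalPhysics.QuantumLattice
open Summit.HubbardSuperconductivity.HubbardSuperconductivity.Theorems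

section Weighted

variable {G : ℝ → ℂ} {L r : ℝ} {W : ℝ → ℂ} {LW BW δW : ℝ}

/-- **Pointwise, quasi-Lipschitz insertion**: `‖Ψ_G(k₀,e)·(W(e) − W(0))‖ ≤ L·r⁴·(L_W·r + δ_W)` everywhere (`= 0` off the disc). -/
theorem klzw_norm_integrand_sub_le_quasi (hlip : ∀ s s', ‖G s - G s'‖ ≤ L * |s - s'|) (hsupp : ∀ s, r ^ 2 ≤ s → G s = 0) (hr : 0 < r)
    (hLW : 0 ≤ LW) (hδW : 0 ≤ δW) (hWlip : ∀ e : ℝ, |e| < r → ‖W e - W 0‖ ≤ LW * |e| + δW) (k₀ e : ℝ) :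
    ‖G (k₀ ^ 2 + e ^ 2) * (I * k₀ + e) ^ 2 * (W e - W 0)‖ ≤ L * r ^ 4 * (LW * r + δW) := by
  have hL : 0 ≤ L := by
    have := hlip 0 1; have h0 : (0:ℝ) ≤ ‖G 0 - G 1‖ := norm_nonneg _; norm_num at this; linarith
  rcases lt_or_ge (k₀ ^ 2 + e ^ 2) (r ^ 2) with hs | hs
  · have he : |e| < r := by nlinarith [sq_abs e, sq_nonneg k₀, abs_nonneg e]
    rw [norm_mul]
    have h1 := klzw_norm_integrand_le hlip hsupp k₀ e
    have h2 : ‖W e - W 0‖ ≤ LW * r + δW := (hWlip e he).trans (by nlinarith [he.le])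
    exact mul_le_mul h1 h2 (norm_nonneg _) (by positivity)
  · rw [hsupp _ hs, zero_mul, zero_mul, norm_zero]; positivity

/-- **First-order cancellation in the continuum, quasi-Lipschitz insertion**: `‖∫∫ G(k₀²+e²)(ik₀+e)²·W(e)‖ ≤ 4·L·L_W·r⁷ + 4·L·δ_W·r⁶`. -/
theorem klzw_integral_plane_weighted_norm_le_quasi (hlip : ∀ s s', ‖G s - G s'‖ ≤ L * |s - s'|) (hsupp : ∀ s, r ^ 2 ≤ s → G s = 0)
    (hr : 0 < r) (hW : Continuous W) (hLW : 0 ≤ LW) (hδW : 0 ≤ δW) (hWlip : ∀ e : ℝ, |e| < r → ‖W e - W 0‖ ≤ LW * |e| + δW) :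
    ‖∫ p : ℝ × ℝ, G (p.1 ^ 2 + p.2 ^ 2) * (I * p.1 + p.2) ^ 2 * W p.2‖ ≤ 4 * L * LW * r ^ 7 + 4 * L * δW * r ^ 6 := by
  have hL : 0 ≤ L := by
    have := hlip 0 1; have h0 : (0:ℝ) ≤ ‖G 0 - G 1‖ := norm_nonneg _; norm_num at this; linarith
  have hΨ : Continuous fun p : ℝ × ℝ => G (p.1 ^ 2 + p.2 ^ 2) * (I * p.1 + p.2) ^ 2 := klzd_continuous hlip
  have hsuppK : ∀ (c : ℝ × ℝ → ℂ), HasCompactSupport fun p : ℝ × ℝ => G (p.1 ^ 2 + p.2 ^ 2) * (I * p.1 + p.2) ^ 2 * c p := by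
    intro c
    refine HasCompactSupport.intro ((isCompact_Icc (a := -r) (b := r)).prod (isCompact_Icc (a := -r) (b := r))) fun p hp => ?_
    exact klzw_integrand_zero_of_not_mem hsupp hr.le hp (c p)
  have hI1 : Integrable fun p : ℝ × ℝ => G (p.1 ^ 2 + p.2 ^ 2) * (I * p.1 + p.2) ^ 2 * (W p.2 - W 0) :=
    (hΨ.mul ((hW.comp continuous_snd).sub continuous_const)).integrable_of_hasCompactSupport (hsuppK fun p => W p.2 - W 0)
  have hI2 : Integrable fun p : ℝ × ℝ => G (p.1 ^ 2 + p.2 ^ 2) * (I * p.1 + p.2) ^ 2 * W 0 :=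
    (hΨ.mul continuous_const).integrable_of_hasCompactSupport (hsuppK fun _ => W 0)
  have hsplit : (fun p : ℝ × ℝ => G (p.1 ^ 2 + p.2 ^ 2) * (I * p.1 + p.2) ^ 2 * W p.2) =
      fun p => G (p.1 ^ 2 + p.2 ^ 2) * (I * p.1 + p.2) ^ 2 * (W p.2 - W 0) + G (p.1 ^ 2 + p.2 ^ 2) * (I * p.1 + p.2) ^ 2 * W 0 := by
    funext p; ring
  rw [hsplit, integral_add hI1 hI2, integral_mul_const, klzd_integral_plane_eq_zero G, zero_mul, add_zero]
  set c : ℝ := L * r ^ 4 * (LW * r + δW) with hc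
  have hbound : ∀ p : ℝ × ℝ, ‖G (p.1 ^ 2 + p.2 ^ 2) * (I * p.1 + p.2) ^ 2 * (W p.2 - W 0)‖ ≤
      Set.indicator (Set.Icc (-r) r ×ˢ Set.Icc (-r) r) (fun _ => c) p := by
    intro p
    by_cases hp : p ∈ Set.Icc (-r) r ×ˢ Set.Icc (-r) r
    · rw [Set.indicator_of_mem hp]
      exact klzw_norm_integrand_sub_le_quasi hlip hsupp hr hLW hδW hWlip p.1 p.2
    · rw [Set.indicator_of_notMem hp, klzw_integrand_zero_of_not_mem hsupp hr.le hp, norm_zero]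
  have hmeas : MeasurableSet (Set.Icc (-r) r ×ˢ Set.Icc (-r) r : Set (ℝ × ℝ)) := measurableSet_Icc.prod measurableSet_Icc
  have hfin : (volume : Measure (ℝ × ℝ)) (Set.Icc (-r) r ×ˢ Set.Icc (-r) r) ≠ ⊤ := by
    rw [klzw_volume_box r]; exact ENNReal.mul_ne_top ENNReal.ofReal_ne_top ENNReal.ofReal_ne_top
  have hind : Integrable (Set.indicator (Set.Icc (-r) r ×ˢ Set.Icc (-r) r) (fun _ : ℝ × ℝ => c)) :=
    IntegrableOn.integrable_indicator (integrableOn_const (hs := hfin)) hmeas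
  calc ‖∫ p : ℝ × ℝ, G (p.1 ^ 2 + p.2 ^ 2) * (I * p.1 + p.2) ^ 2 * (W p.2 - W 0)‖
      ≤ ∫ p : ℝ × ℝ, Set.indicator (Set.Icc (-r) r ×ˢ Set.Icc (-r) r) (fun _ => c) p :=
        norm_integral_le_of_norm_le hind (Filter.Eventually.of_forall hbound)
    _ = ((volume : Measure (ℝ × ℝ)) (Set.Icc (-r) r ×ˢ Set.Icc (-r) r)).toReal * c := by
        rw [integral_indicator_const _ hmeas, smul_eq_mul, Measure.real]
    _ = (2 * r) * (2 * r) * c := by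
        rw [klzw_volume_box r, ENNReal.toReal_mul, ENNReal.toReal_ofReal (by linarith)]
    _ = 4 * L * LW * r ^ 7 + 4 * L * δW * r ^ 6 := by rw [hc]; ring

/-- **The weighted zero-sound bubble at finite temperature, QUASI-LIPSCHITZ insertion**: as `klzw_discrete_weighted_bubble_norm_le` with `‖W(e) − W(0)‖ ≤ L_W|e| + δ_W`:
`‖β⁻¹ • Σ_i ∫ G(ω_i² + e²)(iω_i + e)² W(e) de‖ ≤ (2π)⁻¹·(4·L·L_W·r⁷ + 4·L·δ_W·r⁶) + 8·L·B_W·r⁴·(r + 2π/β)/β`. -/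
theorem klzw_discrete_weighted_bubble_norm_le_quasi (hlip : ∀ s s', ‖G s - G s'‖ ≤ L * |s - s'|)
    (hsupp : ∀ s, r ^ 2 ≤ s → G s = 0) (hr : 0 < r) (hW : Continuous W) (hLW : 0 ≤ LW) (hδW : 0 ≤ δW) (hBW : 0 ≤ BW)
    (hWlip : ∀ e : ℝ, |e| < r → ‖W e - W 0‖ ≤ LW * |e| + δW) (hWbd : ∀ e : ℝ, |e| < r → ‖W e‖ ≤ BW)
    {β : ℝ} (hβ : 0 < β) {M : ℕ} (hM : β * r / (2 * Real.pi) + 1 ≤ M) :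
    ‖β⁻¹ • ∑ i : MatsubaraIdx M,
        ∫ e : ℝ, G (matsubaraFreq β M i ^ 2 + e ^ 2) * (I * (matsubaraFreq β M i) + e) ^ 2 * W e‖ ≤
      (2 * Real.pi)⁻¹ * (4 * L * LW * r ^ 7 + 4 * L * δW * r ^ 6) + 8 * L * BW * r ^ 4 * (r + 2 * Real.pi / β) / β := by
  have hL : 0 ≤ L := by
    have := hlip 0 1; have h0 : (0:ℝ) ≤ ‖G 0 - G 1‖ := norm_nonneg _; norm_num at this; linarith
  set g : ℝ → ℂ := fun k₀ => ∫ e : ℝ, G (k₀ ^ 2 + e ^ 2) * (I * k₀ + e) ^ 2 * W e with hg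
  have hD : 0 ≤ 8 * L * BW * r ^ 4 := by positivity
  have hglip : ∀ t t', ‖g t - g t'‖ ≤ 8 * L * BW * r ^ 4 * |t - t'| := fun t t' =>
    klzw_freqFn_lipschitz hlip hsupp hr hW hBW hWbd t t'
  have hgsupp : ∀ t, r ≤ |t| → g t = 0 := fun t ht => klzw_freqFn_zero hsupp hr.le ht
  have h1 := klmr_matsubara_sum_sub_integral_norm_le hD hglip hr.le hgsupp hβ hM
  have h2 : ‖(2 * Real.pi)⁻¹ • ∫ t, g t‖ ≤ (2 * Real.pi)⁻¹ * (4 * L * LW * r ^ 7 + 4 * L * δW * r ^ 6) := by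
    rw [norm_smul, Real.norm_of_nonneg (by positivity), hg, klzw_integral_freqFn_eq hlip hsupp hr.le hW]
    exact mul_le_mul_of_nonneg_left (klzw_integral_plane_weighted_norm_le_quasi hlip hsupp hr hW hLW hδW hWlip) (by positivity)
  calc ‖β⁻¹ • ∑ i : MatsubaraIdx M, g (matsubaraFreq β M i)‖
      = ‖(β⁻¹ • ∑ i : MatsubaraIdx M, g (matsubaraFreq β M i) - (2 * Real.pi)⁻¹ • ∫ t, g t) + (2 * Real.pi)⁻¹ • ∫ t, g t‖ := by
        rw [sub_add_cancel]
    _ ≤ ‖β⁻¹ • ∑ i : MatsubaraIdx M, g (matsubaraFreq β M i) - (2 * Real.pi)⁻¹ • ∫ t, g t‖ + ‖(2 * Real.pi)⁻¹ • ∫ t, g t‖ :=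
        norm_add_le _ _
    _ ≤ 8 * L * BW * r ^ 4 * (r + 2 * Real.pi / β) / β + (2 * Real.pi)⁻¹ * (4 * L * LW * r ^ 7 + 4 * L * δW * r ^ 6) := add_le_add h1 h2
    _ = (2 * Real.pi)⁻¹ * (4 * L * LW * r ^ 7 + 4 * L * δW * r ^ 6) + 8 * L * BW * r ^ 4 * (r + 2 * Real.pi / β) / β := by ring

end Weighted

end Summit.HubbardSuperconductivity.HubbardSuperconductivity.Theorems.KLRegimeSplit

end
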